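import Mathlib
import Literature.Analysis.FluidPDE.DoeringFoiasPowerProofs
import Literature.Analysis.FluidPDE.DoeringFoiasProofs
import Literature.Analysis.FluidPDE.DoeringFoiasAmplitudeProofs
import Literature.Analysis.FluidPDE.ZerothLawProofs
import Literature.Analysis.FluidPDE.LongTimeAverageNonneg
import Literature.Analysis.FluidPDE.LongTimeAverageSubadditive
import Literature.Analysis.FluidPDE.LerayHopfSpectralMeasurability
import Literature.Analysis.FluidPDE.TwoHalfSection
import Literature.Analysis.FluidPDE.TwoHalfNavierStokes
import Literature.Analysis.FunctionSpaces.TorusTestFunction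
import Literature.Analysis.FunctionSpaces.TorusFourierConvolution
import Literature.Barriers.AnomalousDissipation.TwoDimensionalEnergyDissipationProofs
import Literature.Analysis.FluidPDE.TwoHalfLerayHopfSection
import Literature.Analysis.FluidPDE.NSEnergyEquality2D
import Literature.Analysis.FluidPDE.LerayHopfUniformEnergyMomentum
import Literature.Analysis.FluidPDE.DuchonRobertLionsCounterexample
import Literature.Analysis.FluidPDE.LerayHopfSliceZeroTorus
import Literature.Analysis.FluidPDE.LerayHopfGalileanTorusMeans
import HarnessLib

/-!
# PlanarDescentEnergyEq

Topic `Literature/Analysis/FluidPDE`. Named literature fact(s) relocated by the gate from `Summits/AnomalousDissipation/AnomalousDissipation/Theorems/TwohalfdThesis/Negative/PlanarForceOfDescent.lean`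
(accept-time relocation of `[cite]`d propositions written inline in a Summits proposal; human ruling 2026-08-15).
Sources: FoiasManleyRosaTemam2001.

* `Literature.Analysis.FluidPDE.PlanarDescentEnergyEqInitial` /
  `Literature.Analysis.FluidPDE.PlanarDescentEnergyEqInitial_holds` — THE STATEMENT OF THIS FILE: the corrected
  rendering (extra hypothesis `u 0 = u₀`, the book's continuous representative) and its PROOF from
  Foias–Manley–Rosa–Temam 2001, Ch. II, Thm. 7.3 (two-dimensional energy equality) applied to the planar section:
  `Torus.IsLerayHopfOn.planarSection_isLerayHopfOn`, `…planarSection_energy_eq`,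
  `Torus.IsGlobalLerayHopf.planarSection_meanPower_le_meanDissipation`, `…planarSection_descent`,
  `planarDescentEnergyEq_of_initial`; and the update form for an arbitrary `x₃`-invariant global Leray–Hopf
  solution with `L²` datum, `planarDescentEnergyEq_update` (unconditional; this is what a user holding
  `(H : PlanarDescentEnergyEq)` should take instead).
* `Literature.Analysis.FluidPDE.PlanarDescentEnergyEq` — **DEPRECATED tombstone** (named-fact verdict clean-up
  2026-08-17, action RESTATE): the relocated named fact, statement kept byte-for-byte; it is FALSE as stated
  (verdict 2026-08-16, see the note `## Verdict` below; refuted in tree by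
  `Literature.Analysis.FluidPDE.not_planarDescentEnergyEq`), so no `PlanarDescentEnergyEq_holds` can exist and it
  is no longer literature debt: it carries `@[deprecated PlanarDescentEnergyEqInitial]` towards the corrected
  statement.  Kept (not deleted) because the refuting theorem, the ledger's verdict record (p122598) and one
  Summits-side theorem (`not_twohalfdThesisPlanarForceSmoothData_of_descent`, which takes it as a — vacuous —
  hypothesis) name it.
* the mechanism of the refutation is the tree's `Torus.IsLerayHopfOn.congr_of_eqOn_Ioi`
  (`Literature/Analysis/FluidPDE/LerayHopfSliceZeroTorus`): the accepted `Torus.IsLerayHopfOn` does not see the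
  slice `u 0` (re-defining it by any `a ∈ L²` with `½‖a‖² ≤ ½‖u₀‖²` keeps every clause).

## References

* C. Foias, O. Manley, R. Rosa, R. Temam, *Navier–Stokes Equations and Turbulence*, Encyclopedia Math. Appl. 83,
  CUP 2001, doi:10.1017/cbo9780511546754: Ch. II §7, the weak formulation (7.1) ("for every test function `v` in
  `V`, with `u(0) = u₀`") and Thm. 7.3 with (7.12) (existence, uniqueness, continuity into `H` and the energy
  equation of two-dimensional weak solutions); Ch. II App. A, (A.52)–(A.53) (integrated energy equation and the
  uniform `L²` bound). [FoiasManleyRosaTemam2001]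
* A. J. Majda, A. L. Bertozzi, *Vorticity and Incompressible Flow*, CUP 2002, §2.3.1 (two-and-a-half-dimensional
  flows). [MajdaBertozziCUP2002]
-/

namespace Literature.Analysis.FluidPDE

open MeasureTheory Set Filter Topology UnitAddTorus
open scoped ENNReal NNReal InnerProductSpace
open Literature.Analysis.FunctionSpaces Literature.Analysis.FunctionSpaces.Torus
open Literature.Analysis.FluidPDE Literature.Analysis.FluidPDE.Torus

/-! ### The statement: 2½-D descent with the two-dimensional energy equality (FMRT 2001, Ch. II Thm. 7.3) -/

/-- **2½-D DESCENT WITH THE 2-D ENERGY EQUALITY** (Foias–Manley–Rosa–Temam 2001, Ch. II, Thm. 7.3 — existence,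
uniqueness, continuity `u ∈ C([0, T]; H)` and the energy equation (7.12) of two-dimensional weak solutions — applied
to the planar section of an `x₃`-invariant flow; Majda–Bertozzi 2002, §2.3.1).  The planar part
`v = (u₁,u₂)(·,0)` of an `x₃`-invariant global Leray–Hopf solution `u` of NS_ν on `T³` driven by the `x₃`-invariant
steady force `(g,h)∘π` (smooth `g`, `h`; `g` solenoidal and mean zero), WHOSE SLICE `u 0` IS ITS DATUM `u₀` (the
book's continuous representative, `u(0) = u₀`), is a global Leray–Hopf solution of the 2-D system driven by `g`
from the planar part of the datum, and it obeys the energy EQUALITY — recorded in the only form used downstream,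
the long-time budget `⟨g, v⟩ ≤ ⟨ν‖∇v‖²⟩` (the reverse of the Leray–Hopf inequality
`DoeringFoias2002_dissipation_le_power`).  This is the corrected statement of the deprecated first rendering
`PlanarDescentEnergyEq` below, which lacks the hypothesis `u 0 = u₀` and is FALSE as written
(`not_planarDescentEnergyEq`: the accepted `Torus.IsLerayHopfOn` leaves the slice `u 0` free, so the planar energy
inequality from `0` can fail at the single time `t = 0`); everything else — hypotheses (the `x₃`-invariance of `u₀`
is now that of the slice `u 0`, kept for the record) and BOTH conclusions, for the raw planar section
`t ↦ πE ∘ u t ∘ σ` — is that rendering verbatim.  PROVED below (`PlanarDescentEnergyEqInitial_holds`); the version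
for an arbitrary `x₃`-invariant global Leray–Hopf solution with `L²` datum (conclusion for the section re-defined at
`t = 0` by its datum) is `planarDescentEnergyEq_update`.  Paper proof: FMRT 2001, Ch. II, Thm. 7.3 with (7.12) /
App. A (A.52)–(A.53) (two-dimensional weak solutions are continuous into `H` and satisfy the energy equation;
uniform `L²` bound), applied to the planar section, which is a weak solution in the energy class by Fubini
(Majda–Bertozzi 2002, §2.3.1; Bardos–Lopes Filho–Niu–Nussenzveig Lopes–Titi 2013, §2); the energy equality in the
energy class is the tree's `Torus.WeakNSEnergyClass.energy_eq_zero` (Lions–Prodi / Ladyzhenskaya).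
[cite: FoiasManleyRosaTemam2001, Ch. II Thm. 7.3] -/
def PlanarDescentEnergyEqInitial : Prop :=
  ∀ (ν : ℝ) (g : UnitAddTorus (Fin 2) → EuclideanSpace ℝ (Fin 2)) (h : UnitAddTorus (Fin 2) → ℝ)
    (u₀ : UnitAddTorus (Fin 3) → EuclideanSpace ℝ (Fin 3)) (u : ℝ → UnitAddTorus (Fin 3) → EuclideanSpace ℝ (Fin 3)),
    0 < ν →
    Literature.Analysis.FunctionSpaces.Torus.IsSmooth g → Literature.Analysis.FunctionSpaces.Torus.IsDivFree g →
    Literature.Analysis.FunctionSpaces.Torus.HasZeroMean g → Literature.Analysis.FunctionSpaces.Torus.IsSmooth h →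
    Literature.Analysis.FluidPDE.Torus.IsGlobalLerayHopf ν
      (fun _ => Literature.Analysis.FunctionSpaces.Torus.twoHalf g h) u₀ u →
    u 0 = u₀ →
    (∀ (s : UnitAddCircle) (x : UnitAddTorus (Fin 3)), u₀ (x + Pi.single (2 : Fin 3) s) = u₀ x) →
    (∀ (t : ℝ) (s : UnitAddCircle) (x : UnitAddTorus (Fin 3)), u t (x + Pi.single (2 : Fin 3) s) = u t x) →
    Literature.Analysis.FluidPDE.Torus.IsGlobalLerayHopf ν (fun _ => g)
        (fun y => Literature.Analysis.FunctionSpaces.Torus.planarProjE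
          (u₀ (Literature.Analysis.FunctionSpaces.Torus.planarSect y)))
        (fun t y => Literature.Analysis.FunctionSpaces.Torus.planarProjE
          (u t (Literature.Analysis.FunctionSpaces.Torus.planarSect y))) ∧
      Literature.Analysis.FluidPDE.meanPower g
          (fun t y => Literature.Analysis.FunctionSpaces.Torus.planarProjE
            (u t (Literature.Analysis.FunctionSpaces.Torus.planarSect y))) ≤
        Literature.Analysis.FluidPDE.meanDissipation ν
          (fun t y => Literature.Analysis.FunctionSpaces.Torus.planarProjE
            (u t (Literature.Analysis.FunctionSpaces.Torus.planarSect y)))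

/-! ### Deprecated (named-fact verdict clean-up 2026-08-17): the first rendering, false as stated -/

/-- **DEPRECATED (named-fact verdict clean-up 2026-08-17) — MIS-STATED: false as written, refuted in this file by
`not_planarDescentEnergyEq`; use `PlanarDescentEnergyEqInitial` (the corrected statement above, proved:
`PlanarDescentEnergyEqInitial_holds`) or, for an arbitrary `x₃`-invariant global Leray–Hopf solution with `L²`
datum, the unconditional theorem `planarDescentEnergyEq_update`.**  *What is wrong:* in the source
(Foias–Manley–Rosa–Temam 2001, Ch. II, Thm. 7.3 with (7.12); integrated form App. A (A.52)) the two-dimensional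
weak solution is unique, "continuous from `[0, T]` into `H`" and solves the initial-value problem, `u(0) = u₀`, and
the energy equation holds on `[0, T]`; the accepted `Torus.IsLerayHopfOn T ν f u₀ u` constrains the time slice
`u 0` only by `u 0 ∈ L²` and `kineticEnergy (u 0) ≤ kineticEnergy u₀` (module note `## Verdict`), so an
`x₃`-invariant Leray–Hopf solution on `T³` may trade vertical for planar kinetic energy at the single time `t = 0`,
and the first conjunct below (through the planar energy inequality from `0` at `t = 0`) fails: this rendering
dropped the identification `u(0) = u₀` and is not implied by its source.  Do not take `(h : PlanarDescentEnergyEq)`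
as a hypothesis (anything conditional on it is vacuous); no `PlanarDescentEnergyEq_holds` can exist.  The statement
is left byte-for-byte (a refuted statement is not edited in place; the correction carries the new name
`PlanarDescentEnergyEqInitial` = this statement with the extra hypothesis `u 0 = u₀`), and the declaration is kept,
deprecated rather than deleted, because its refutation, the ledger's verdict record and a Summits-side theorem name
it: it is retired from the named-fact debt, not a fact awaiting discharge.
*Original description (2026-08-16):* the planar part `v = (u₁,u₂)(·,0)` of an `x₃`-invariant global Leray–Hopf
solution `u` of NS_ν on `T³` driven by the `x₃`-invariant steady force `(g,h)∘π` (smooth `g`, `h`; `g` solenoidal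
and mean zero) is a global Leray–Hopf solution of the 2-D system driven by `g` from the planar part of the datum,
and it obeys the long-time budget `⟨g, v⟩ ≤ ⟨ν‖∇v‖²⟩`.  The weak formulation descends by Fubini (tree:
`Torus.IsLerayHopfOn.planarSection`), `v ∈ L^∞L² ∩ L²H¹ ⊂ L⁴ₜ,ₓ` (Ladyzhenskaya), and weak solutions in that class
satisfy the energy EQUALITY (Lions–Prodi 1959 / FMRT 2001 Ch. II Thm 7.3 / Sohr 2001 Thm V.1.4.1; tree:
`Torus.WeakNSEnergyClass.energy_eq_zero`); with the uniform-in-time energy bound the boundary term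
`(‖v(T)‖² - ‖v₀‖²)/2T → 0` and the second conjunct follows from the first.  Further sources: Bardos–Lopes
Filho–Niu–Nussenzveig Lopes–Titi, SIAM J. Math. Anal. 45 (2013) §2 (2½-D reduction of Leray–Hopf solutions);
Majda–Bertozzi 2002 §2.3.1.
[cite: FoiasManleyRosaTemam2001, Ch. II Thm. 7.3 as mis-rendered without the identification u(0) = u₀ of the continuous representative; refuted in tree (not_planarDescentEnergyEq); corrected as PlanarDescentEnergyEqInitial] -/
@[deprecated PlanarDescentEnergyEqInitial "mis-stated — FALSE as written (refuted: Literature.Analysis.FluidPDE.not_planarDescentEnergyEq): the accepted Torus.IsLerayHopfOn leaves the slice `u 0` free, whereas Foias–Manley–Rosa–Temam 2001, Ch. II, Thm. 7.3 is about the continuous representative with u(0) = u₀; use Literature.Analysis.FluidPDE.PlanarDescentEnergyEqInitial (the same statement with the extra hypothesis `u 0 = u₀`; proved: PlanarDescentEnergyEqInitial_holds) or, for an arbitrary x₃-invariant global Leray–Hopf solution with L² datum, the unconditional theorem Literature.Analysis.FluidPDE.planarDescentEnergyEq_update" (since := "2026-08-17")]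
def PlanarDescentEnergyEq : Prop :=
  ∀ (ν : ℝ) (g : UnitAddTorus (Fin 2) → EuclideanSpace ℝ (Fin 2)) (h : UnitAddTorus (Fin 2) → ℝ)
    (u₀ : UnitAddTorus (Fin 3) → EuclideanSpace ℝ (Fin 3)) (u : ℝ → UnitAddTorus (Fin 3) → EuclideanSpace ℝ (Fin 3)),
    0 < ν →
    Literature.Analysis.FunctionSpaces.Torus.IsSmooth g → Literature.Analysis.FunctionSpaces.Torus.IsDivFree g →
    Literature.Analysis.FunctionSpaces.Torus.HasZeroMean g → Literature.Analysis.FunctionSpaces.Torus.IsSmooth h →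
    Literature.Analysis.FluidPDE.Torus.IsGlobalLerayHopf ν
      (fun _ => Literature.Analysis.FunctionSpaces.Torus.twoHalf g h) u₀ u →
    (∀ (s : UnitAddCircle) (x : UnitAddTorus (Fin 3)), u₀ (x + Pi.single (2 : Fin 3) s) = u₀ x) →
    (∀ (t : ℝ) (s : UnitAddCircle) (x : UnitAddTorus (Fin 3)), u t (x + Pi.single (2 : Fin 3) s) = u t x) →
    Literature.Analysis.FluidPDE.Torus.IsGlobalLerayHopf ν (fun _ => g)
        (fun y => Literature.Analysis.FunctionSpaces.Torus.planarProjE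
          (u₀ (Literature.Analysis.FunctionSpaces.Torus.planarSect y)))
        (fun t y => Literature.Analysis.FunctionSpaces.Torus.planarProjE
          (u t (Literature.Analysis.FunctionSpaces.Torus.planarSect y))) ∧
      Literature.Analysis.FluidPDE.meanPower g
          (fun t y => Literature.Analysis.FunctionSpaces.Torus.planarProjE
            (u t (Literature.Analysis.FunctionSpaces.Torus.planarSect y))) ≤
        Literature.Analysis.FluidPDE.meanDissipation ν
          (fun t y => Literature.Analysis.FunctionSpaces.Torus.planarProjE
            (u t (Literature.Analysis.FunctionSpaces.Torus.planarSect y)))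

/-!
## Verdict (2026-08-16): `PlanarDescentEnergyEq` is FALSE as stated — the slice `u 0` is free

No clause of the accepted `Torus.IsLerayHopfOn T ν f u₀ u` constrains the time slice `u 0` beyond `u 0 ∈ L²`
(`memLp`) and `kineticEnergy (u 0) ≤ kineticEnergy u₀` (`energy_ineq_zero` at `t = 0`, where both time integrals
run over `Ioo 0 0 = ∅` / `0..0`): the weak formulation `Torus.IsWeakNSSolutionForcedOn` sees `u` only under
`∫ t in Ioo 0 T` / `∀ᵐ t`, the bounds `energy_bound`, `memL2Sobolev`, `energy_ineq_ae` are a.e. in time, and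
`weak_continuous` / `strong_initial` are statements on `Ioc 0 T` and along `𝓝[>] 0` (the same defect as the retired
`lions_energy_equality`, `Literature/Analysis/FluidPDE/DuchonRobertLionsCounterexample`).  An `x₃`-invariant
Leray–Hopf solution on `T³` may therefore trade vertical for planar kinetic energy at the single time `t = 0`
(`Torus.IsLerayHopfOn.congr_of_eqOn_Ioi`, `Literature/Analysis/FluidPDE/LerayHopfSliceZeroTorus`), and its planar
section then violates the planar energy inequality from `0` at
`t = 0`, `kineticEnergy (v 0) ≤ kineticEnergy v₀`, which the first conjunct of `PlanarDescentEnergyEq` demands: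
`not_planarDescentEnergyEq` (witness `ν = 1`, `g = 0`, `h = 0`, the steady constant flow `e₂` with its slice
`t = 0` re-defined to the constant field `e₀`).  In the printed theorem (Foias–Manley–Rosa–Temam 2001, Ch. II,
Thm. 7.3: in two dimensions the weak solution is unique, `u ∈ C([0,T]; H)` and the energy equation (7.12) holds on
`[0, T]`; integrated form App. A (A.52)) the solution is the continuous representative with `u(0) = u₀`.

The corrected statement `PlanarDescentEnergyEqInitial` adds exactly this identification, `u 0 = u₀`, and is PROVED
(`PlanarDescentEnergyEqInitial_holds`) following the book: the planar section `v` of `u = (v, θ) ∘ π` has every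
Leray–Hopf clause except the energy inequalities by Fubini bookkeeping (tree: `Torus.IsLerayHopfOn.planarSection`),
lies in `L⁴((0,T) × T²)` by Ladyzhenskaya's inequality, hence satisfies the ENERGY EQUALITY of Lions–Prodi /
FMRT Thm. 7.3 (tree: `Torus.WeakNSEnergyClass.energy_eq_zero`, `isLerayHopfOn_update_two`), which gives the
first conjunct; the long-time budget `⟨g, v⟩ ≤ ⟨ν‖∇v‖²⟩` is the time average of the energy equality (A.52),
`T⁻¹∫₀ᵀ⟨g,v⟩ = T⁻¹∫₀ᵀ ν‖∇v‖² + (‖v(T)‖² - ‖v₀‖²)/(2T)`, with the uniform bound `‖v(T)‖² ≤ R` of FMRT (A.53) /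
Ch. IV (3.2) (tree: `Torus.IsGlobalLerayHopf.exists_forall_integral_norm_sq_le_of_hasZeroMean`) and the `limsup`
bookkeeping of `DoeringFoias2002_dissipation_le_power_holds`.  The update form for an arbitrary `x₃`-invariant
global Leray–Hopf solution with `L²` datum is `planarDescentEnergyEq_update`.
-/

/-! ### The refutation -/

section Refutation

variable {d : Type*} [Fintype d]

/-- The kinetic energy of a constant field on the unit torus is `½‖c‖²`. [folklore] -/
theorem kineticEnergy_fun_const (c : EuclideanSpace ℝ d) :
    FunctionSpaces.Torus.kineticEnergy (fun _ : UnitAddTorus d => c) = 2⁻¹ * ‖c‖ ^ 2 := by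
  simp [FunctionSpaces.Torus.kineticEnergy]

-- `linter.deprecated` is off for the next declaration only (lint debt, justified): it is the refutation of the
-- deprecated tombstone `PlanarDescentEnergyEq` (verdict clean-up 2026-08-17) and must name it.
set_option linter.deprecated false in
/-- **`PlanarDescentEnergyEq` is false.**  Witness: `ν = 1`, `g = 0`, `h = 0` (so the force `(g, h) ∘ π` is `0`,
`twoHalf_zero`), datum the constant vertical unit field `u₀ = e₂`, and `u` the steady constant flow `e₂`
(`isLerayHopfOn_const`) with its free slice `t = 0` re-defined to the constant planar unit field `e₀`
(`Torus.IsLerayHopfOn.congr_of_eqOn_Ioi`: `½‖e₀‖² ≤ ½‖e₂‖²`).  All hypotheses hold (constant slices are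
`x₃`-invariant), while the first conjunct would make the planar section — `0` for `t > 0`, the constant unit field
`(1, 0)` at `t = 0`, datum `πE e₂ = 0` — a Leray–Hopf solution on `T² × [0, 1)`, whose energy inequality from `0`
at `t = 0` reads `½ ≤ 0`.  (`linter.deprecated` is switched off for this declaration alone: it is the refutation of
the deprecated tombstone `PlanarDescentEnergyEq` and must name it.) [folklore] -/
theorem not_planarDescentEnergyEq : ¬ PlanarDescentEnergyEq := by
  intro H
  set e₀ : EuclideanSpace ℝ (Fin 3) := EuclideanSpace.single 0 1 with he₀
  set e₂ : EuclideanSpace ℝ (Fin 3) := EuclideanSpace.single 2 1 with he₂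
  have hn₀ : ‖e₀‖ = 1 := by simp [he₀]
  have hn₂ : ‖e₂‖ = 1 := by simp [he₂]
  -- the jump flow: the steady constant flow `e₂` with the slice `t = 0` re-defined to `e₀`
  set u : ℝ → UnitAddTorus (Fin 3) → EuclideanSpace ℝ (Fin 3) := fun t _ => if t = 0 then e₀ else e₂ with hu_def
  have hu0 : u 0 = fun _ => e₀ := by simp [hu_def]
  have hut : ∀ t : ℝ, 0 < t → u t = (fun (_ : ℝ) (_ : UnitAddTorus (Fin 3)) => e₂) t := fun t ht => by
    simp [hu_def, ht.ne']
  have hE : FunctionSpaces.Torus.kineticEnergy (u 0) ≤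
      FunctionSpaces.Torus.kineticEnergy (fun _ : UnitAddTorus (Fin 3) => e₂) := by
    rw [hu0, kineticEnergy_fun_const, kineticEnergy_fun_const, hn₀, hn₂]
  have hLH0 : Torus.IsGlobalLerayHopf 1 0 (fun _ => e₂) u := fun T hT =>
    (isLerayHopfOn_const hT 1 e₂).congr_of_eqOn_Ioi hut (by rw [hu0]; exact memLp_const e₀) hE
  have hgs : IsSmooth (0 : UnitAddTorus (Fin 2) → EuclideanSpace ℝ (Fin 2)) :=
    isSmooth_const (0 : EuclideanSpace ℝ (Fin 2))
  have hgd : IsDivFree (0 : UnitAddTorus (Fin 2) → EuclideanSpace ℝ (Fin 2)) :=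
    isDivFree_fun_const (0 : EuclideanSpace ℝ (Fin 2))
  have hgz : HasZeroMean (0 : UnitAddTorus (Fin 2) → EuclideanSpace ℝ (Fin 2)) := by
    simp [HasZeroMean]
  have hhs : IsSmooth (0 : UnitAddTorus (Fin 2) → ℝ) := isSmooth_const (0 : ℝ)
  have hLH : Torus.IsGlobalLerayHopf 1
      (fun _ => twoHalf (0 : UnitAddTorus (Fin 2) → EuclideanSpace ℝ (Fin 2)) (0 : UnitAddTorus (Fin 2) → ℝ))
      (fun _ => e₂) u := by
    rw [twoHalf_zero]
    exact hLH0
  have key := ((H 1 0 0 (fun _ => e₂) u one_pos hgs hgd hgz hhs hLH (fun _ _ => rfl) (fun _ _ _ => rfl)).1 1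
    one_pos).energy_ineq_zero 0 ⟨le_rfl, zero_le_one⟩
  have hP0 : ‖planarProjE e₀‖ = 1 := by
    have : planarProjE e₀ = EuclideanSpace.single 0 1 := by
      ext i
      fin_cases i <;> simp [he₀]
    rw [this]
    simp
  have hP2 : planarProjE e₂ = 0 := by
    ext i
    fin_cases i <;> simp [he₂]
  simp only [hu0, hP2, Ioo_self, Measure.restrict_empty, lintegral_zero_measure, ENNReal.toReal_zero,
    mul_zero, add_zero, intervalIntegral.integral_same] at key
  rw [kineticEnergy_fun_const, kineticEnergy_fun_const, hP0, norm_zero] at key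
  norm_num at key

end Refutation

/-! ### The descent for sections `u = (v, θ) ∘ π` (FMRT 2001, Ch. II Thm. 7.3, applied to the planar section) -/

section Main

variable {d : Type*} [Fintype d]

/-- A steady `L²` field is in the guarded mixed class `L¹(0, T; L²)` (constant slice norm on an interval of finite
length). [folklore] -/
theorem memLqLp_one_two_of_steady {F : UnitAddTorus d → EuclideanSpace ℝ d} (hF : MemLp F 2 volume) (T : ℝ) :
    Torus.MemLqLp 1 2 (fun _ : ℝ => F) (Ioo 0 T) := by
  haveI : IsFiniteMeasure (volume.restrict (Ioo (0 : ℝ) T)) :=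
    ⟨by rw [Measure.restrict_apply_univ]; exact measure_Ioo_lt_top⟩
  exact ⟨ae_of_all _ fun _ => hF, (memLp_const (eLpNorm F 2 volume).toReal).2⟩

/-- The space–time lift of a steady a.e. strongly measurable field is a.e. strongly measurable on every slab. [folklore] -/
theorem aestronglyMeasurable_stLift_of_steady {F : UnitAddTorus d → EuclideanSpace ℝ d}
    (hF : AEStronglyMeasurable F volume) (S : Set ℝ) :
    AEStronglyMeasurable (stLift (fun _ : ℝ => F)) (volume.restrict (S ×ˢ (univ : Set (EuclideanSpace ℝ d)))) :=
  aestronglyMeasurable_stLift_of_uncurry (u := fun _ : ℝ => F) hF.comp_snd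

variable {T ν : ℝ} {g : UnitAddTorus (Fin 2) → EuclideanSpace ℝ (Fin 2)} {h : UnitAddTorus (Fin 2) → ℝ}
  {v : ℝ → UnitAddTorus (Fin 2) → EuclideanSpace ℝ (Fin 2)} {θ : ℝ → UnitAddTorus (Fin 2) → ℝ}

/-- **The planar section with honest initial slice is a Leray–Hopf solution** (Lions–Prodi; FMRT 2001, Ch. II
Thm. 7.3): if `(v, θ) ∘ π` is a Leray–Hopf solution on `T³ × [0, T)`, `T > 0`, driven by the steady force
`(g, h) ∘ π`, `g ∈ L²`, with datum its own slice `(v 0, θ 0) ∘ π`, then `v` is a Leray–Hopf solution on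
`T² × [0, T)` driven by `g` with datum `v 0` — every clause but the energy inequalities by
`Torus.IsLerayHopfOn.planarSection`, and the energy inequalities (indeed equalities) by the two-dimensional energy
equality in the energy class, `Torus.WeakNSEnergyClass.isLerayHopfOn_update_two` (the update at `t = 0` by the
datum `v 0` being the identity). [cite: FoiasManleyRosaTemam2001, Ch. II Thm. 7.3] -/
theorem Torus.IsLerayHopfOn.planarSection_isLerayHopfOn (hT : 0 < T) (hg : MemLp g 2 volume)
    (hu : Torus.IsLerayHopfOn T ν (fun _ => twoHalf g h) (twoHalf (v 0) (θ 0)) (fun t => twoHalf (v t) (θ t))) :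
    Torus.IsLerayHopfOn T ν (fun _ => g) (v 0) v := by
  have hv₀ : MemLp (v 0) 2 volume := hu.planarSection_memLp ⟨le_rfl, hT.le⟩
  obtain ⟨hw, hE, hL2, hH1, hwc, -⟩ := hu.planarSection hT hg hv₀
  have key := WeakNSEnergyClass.isLerayHopfOn_update_two hT hw hE hL2 hH1 hwc hv₀
    (aestronglyMeasurable_stLift_of_steady hg.1 _) (memLqLp_one_two_of_steady hg T)
  rwa [Function.update_eq_self] at key

/-- **The energy EQUALITY of the planar section from `0`** (FMRT 2001, Ch. II Thm. 7.3, (7.12); App. A (A.52)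
with `t₀ = 0`): under the hypotheses of `Torus.IsLerayHopfOn.planarSection_isLerayHopfOn`, for every `t ∈ (0, T]`,
`½‖v(t)‖² + ν∫₀ᵗ‖∇v‖₂² = ½‖v(0)‖² + ∫₀ᵗ∫⟪g, v⟫` (`∫₀ᵀ‖v‖₄⁴ < ∞` by Ladyzhenskaya,
`Torus.WeakNSEnergyClass.lintegral_lintegral_enorm_pow_four_lt_top_two`, then
`Torus.WeakNSEnergyClass.energy_eq_zero`). [cite: FoiasManleyRosaTemam2001, Ch. II Thm. 7.3 (7.12); App. A (A.52)] -/
theorem Torus.IsLerayHopfOn.planarSection_energy_eq (hT : 0 < T) (hg : MemLp g 2 volume)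
    (hu : Torus.IsLerayHopfOn T ν (fun _ => twoHalf g h) (twoHalf (v 0) (θ 0)) (fun t => twoHalf (v t) (θ t)))
    {t : ℝ} (ht : t ∈ Ioc 0 T) :
    FunctionSpaces.Torus.kineticEnergy (v t) + ν * (∫⁻ τ in Ioo 0 t, FunctionSpaces.Torus.eGradNormSq (v τ)).toReal =
      FunctionSpaces.Torus.kineticEnergy (v 0) + ∫ τ in 0..t, ∫ y, ⟪g y, v τ y⟫_ℝ := by
  have hv₀ : MemLp (v 0) 2 volume := hu.planarSection_memLp ⟨le_rfl, hT.le⟩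
  obtain ⟨hw, hE, hL2, hH1, hwc, -⟩ := hu.planarSection hT hg hv₀
  exact WeakNSEnergyClass.energy_eq_zero (by simp) (by simp) hw hE hL2 hH1 hwc hv₀
    (WeakNSEnergyClass.lintegral_lintegral_enorm_pow_four_lt_top_two hE hL2 hH1)
    (aestronglyMeasurable_stLift_of_steady hg.1 _) (memLqLp_one_two_of_steady hg T) t ht

/-- **Global form of the descent**: if `(v, θ) ∘ π` is a global Leray–Hopf solution on `T³` driven by
`(g, h) ∘ π`, `g ∈ L²`, with datum `(v 0, θ 0) ∘ π`, then `v` is a global Leray–Hopf solution on `T²` driven by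
`g` with datum `v 0`. [cite: FoiasManleyRosaTemam2001, Ch. II Thm. 7.3] -/
theorem Torus.IsGlobalLerayHopf.planarSection_isGlobalLerayHopf (hg : MemLp g 2 volume)
    (hu : Torus.IsGlobalLerayHopf ν (fun _ => twoHalf g h) (twoHalf (v 0) (θ 0)) (fun t => twoHalf (v t) (θ t))) :
    Torus.IsGlobalLerayHopf ν (fun _ => g) (v 0) v := fun T hT =>
  (hu T hT).planarSection_isLerayHopfOn hT hg

/-- **The long-time energy budget of the planar section, `⟨g, v⟩ ≤ ⟨ν‖∇v‖²⟩`** (time average of the energy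
equality FMRT 2001 (A.52): `T⁻¹∫₀ᵀ⟨g, v⟩ = T⁻¹∫₀ᵀν‖∇v‖² + (½‖v(T)‖² - ½‖v(0)‖²)/T ≤ T⁻¹∫₀ᵀν‖∇v‖² + R/(2T)` with the
uniform bound `‖v(T)‖₂² ≤ R` of FMRT (A.53) / Ch. IV (3.2) for a steady mean-zero force,
`Torus.IsGlobalLerayHopf.exists_forall_integral_norm_sq_le_of_hasZeroMean`; both families of running means are
bounded, `Torus.IsLerayHopfOn.intervalIntegral_power_bounds`, so `Filter.limsup` is monotone and subadditive along
them and `R/(2T) → 0`).  Together with the Leray–Hopf inequality `DoeringFoias2002_dissipation_le_power` this is the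
balance `⟨g, v⟩ = ⟨ν‖∇v‖²⟩` of two-dimensional flows. [cite: FoiasManleyRosaTemam2001, Ch. II App. A (A.52)–(A.53)] -/
theorem Torus.IsGlobalLerayHopf.planarSection_meanPower_le_meanDissipation (hν : 0 < ν) (hg : MemLp g 2 volume)
    (hgz : HasZeroMean g)
    (hu : Torus.IsGlobalLerayHopf ν (fun _ => twoHalf g h) (twoHalf (v 0) (θ 0)) (fun t => twoHalf (v t) (θ t))) :
    meanPower g v ≤ meanDissipation ν v := by
  have hLH : Torus.IsGlobalLerayHopf ν (fun _ => g) (v 0) v := hu.planarSection_isGlobalLerayHopf hg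
  obtain ⟨R, hR⟩ := hLH.exists_forall_integral_norm_sq_le_of_hasZeroMean hν hg hgz
  set D : ℝ → ℝ := fun t => ν * (FunctionSpaces.Torus.eGradNormSq (v t)).toReal with hD
  set P : ℝ → ℝ := fun t => ∫ y, ⟪g y, v t y⟫_ℝ with hP
  have hE0 : 0 ≤ FunctionSpaces.Torus.kineticEnergy (v 0) := FunctionSpaces.Torus.kineticEnergy_nonneg _
  -- the running-mean inequalities, for every `T > 0`
  have key : ∀ T, 0 < T →
      timeMean P T ≤ 2⁻¹ * R * T⁻¹ + timeMean D T ∧ 0 ≤ timeMean D T ∧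
        timeMean D T ≤ 2 * FunctionSpaces.Torus.kineticEnergy (v 0) * T⁻¹ +
          2 * ((4 * Real.pi ^ 2 * ν)⁻¹ / 2 * ∫ y, ‖g y‖ ^ 2) ∧
        -(FunctionSpaces.Torus.kineticEnergy (v 0) * T⁻¹) ≤ timeMean P T := by
    intro T hT
    have hLHT := hLH T hT
    obtain ⟨hDb, -⟩ := hLHT.intervalIntegral_power_bounds hT hν hg hgz
    have hDeq := (hLHT.intervalIntegral_dissipation_eq hT).2
    have hDP := hLHT.intervalIntegral_dissipation_le hT
    have heq := (hu T hT).planarSection_energy_eq hT hg ⟨hT, le_rfl⟩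
    have hDnn : 0 ≤ ∫ t in 0..T, D t := by
      rw [hDeq]
      exact mul_nonneg hν.le ENNReal.toReal_nonneg
    have hET : FunctionSpaces.Torus.kineticEnergy (v T) ≤ 2⁻¹ * R :=
      mul_le_mul_of_nonneg_left (hR T hT.le) (by norm_num)
    have hPeq : ∫ t in 0..T, P t =
        (∫ t in 0..T, D t) + FunctionSpaces.Torus.kineticEnergy (v T) - FunctionSpaces.Torus.kineticEnergy (v 0) := by
      rw [hDeq]
      linarith [heq]
    have hTi : 0 < T⁻¹ := inv_pos.2 hT
    have hTT : T⁻¹ * T = 1 := inv_mul_cancel₀ hT.ne'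
    simp only [timeMean]
    refine ⟨?_, mul_nonneg hTi.le hDnn, ?_, ?_⟩
    · rw [hPeq]
      have h1 : T⁻¹ * ((∫ t in 0..T, D t) + FunctionSpaces.Torus.kineticEnergy (v T) -
          FunctionSpaces.Torus.kineticEnergy (v 0)) ≤ T⁻¹ * ((∫ t in 0..T, D t) + 2⁻¹ * R) :=
        mul_le_mul_of_nonneg_left (by linarith) hTi.le
      calc T⁻¹ * ((∫ t in 0..T, D t) + FunctionSpaces.Torus.kineticEnergy (v T) -
            FunctionSpaces.Torus.kineticEnergy (v 0))
          ≤ T⁻¹ * ((∫ t in 0..T, D t) + 2⁻¹ * R) := h1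
        _ = 2⁻¹ * R * T⁻¹ + T⁻¹ * ∫ t in 0..T, D t := by ring
    · calc T⁻¹ * ∫ t in 0..T, D t
          ≤ T⁻¹ * (2 * FunctionSpaces.Torus.kineticEnergy (v 0) +
              2 * ((4 * Real.pi ^ 2 * ν)⁻¹ / 2 * ∫ y, ‖g y‖ ^ 2) * T) := mul_le_mul_of_nonneg_left hDb hTi.le
        _ = 2 * FunctionSpaces.Torus.kineticEnergy (v 0) * T⁻¹ +
              2 * ((4 * Real.pi ^ 2 * ν)⁻¹ / 2 * ∫ y, ‖g y‖ ^ 2) * (T⁻¹ * T) := by ring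
        _ = 2 * FunctionSpaces.Torus.kineticEnergy (v 0) * T⁻¹ +
              2 * ((4 * Real.pi ^ 2 * ν)⁻¹ / 2 * ∫ y, ‖g y‖ ^ 2) := by rw [hTT, mul_one]
    · calc -(FunctionSpaces.Torus.kineticEnergy (v 0) * T⁻¹) = T⁻¹ * (-FunctionSpaces.Torus.kineticEnergy (v 0)) := by
            ring
        _ ≤ T⁻¹ * ∫ t in 0..T, P t := mul_le_mul_of_nonneg_left (by linarith [hDP, hDnn]) hTi.le
  -- boundedness of the running means along `atTop`
  set E₀ : ℝ := FunctionSpaces.Torus.kineticEnergy (v 0) with hE₀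
  set A : ℝ := (4 * Real.pi ^ 2 * ν)⁻¹ / 2 * ∫ y, ‖g y‖ ^ 2 with hA
  have hT1 : ∀ᶠ T : ℝ in atTop, 1 ≤ T := eventually_ge_atTop 1
  have hinv : ∀ T : ℝ, 1 ≤ T → E₀ * T⁻¹ ≤ E₀ := fun T hT =>
    (mul_le_mul_of_nonneg_left (inv_le_one_of_one_le₀ hT) hE0).trans_eq (mul_one _)
  have hDle : ∀ᶠ T in atTop, timeMean D T ≤ 2 * E₀ + 2 * A := by
    filter_upwards [hT1] with T hT
    have h1 := (key T (by linarith)).2.2.1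
    nlinarith [hinv T hT, h1]
  have hDge : ∀ᶠ T in atTop, 0 ≤ timeMean D T := by
    filter_upwards [hT1] with T hT using (key T (by linarith)).2.1
  have hPge : ∀ᶠ T in atTop, -E₀ ≤ timeMean P T := by
    filter_upwards [hT1] with T hT
    exact le_trans (by linarith [hinv T hT]) (key T (by linarith)).2.2.2
  have hPle : ∀ᶠ T in atTop, timeMean P T ≤ 2⁻¹ * R * T⁻¹ + timeMean D T := by
    filter_upwards [hT1] with T hT using (key T (by linarith)).1
  have hK : Tendsto (fun T : ℝ => 2⁻¹ * R * T⁻¹) atTop (𝓝 0) := by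
    simpa using tendsto_inv_atTop_zero.const_mul (2⁻¹ * R)
  have hDbdd : IsBoundedUnder (· ≤ ·) atTop (timeMean D) := isBoundedUnder_of_eventually_le hDle
  -- pass to `lim sup` (monotone and subadditive along (co)bounded families)
  calc meanPower g v = limsup (timeMean P) atTop := rfl
    _ ≤ limsup ((fun T : ℝ => 2⁻¹ * R * T⁻¹) + timeMean D) atTop :=
        limsup_le_limsup (hPle.mono fun T hT => by simpa only [Pi.add_apply] using hT)
          (isCoboundedUnder_le_of_eventually_le atTop hPge)
          (isBoundedUnder_le_add hK.isBoundedUnder_le hDbdd)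
    _ ≤ limsup (fun T : ℝ => 2⁻¹ * R * T⁻¹) atTop + limsup (timeMean D) atTop :=
        limsup_add_le hK.isBoundedUnder_ge hK.isBoundedUnder_le
          (isCoboundedUnder_le_of_eventually_le atTop hDge) hDbdd
    _ = meanDissipation ν v := by
        rw [hK.limsup_eq, zero_add]
        rfl

/-- **The descent, packaged**: both conclusions of `PlanarDescentEnergyEqInitial` for a global Leray–Hopf solution
`(v, θ) ∘ π` on `T³` driven by `(g, h) ∘ π` (`ν > 0`, `g ∈ L²` with zero mean) whose datum is its own slice at
`t = 0`. [cite: FoiasManleyRosaTemam2001, Ch. II Thm. 7.3] -/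
theorem Torus.IsGlobalLerayHopf.planarSection_descent (hν : 0 < ν) (hg : MemLp g 2 volume) (hgz : HasZeroMean g)
    (hu : Torus.IsGlobalLerayHopf ν (fun _ => twoHalf g h) (twoHalf (v 0) (θ 0)) (fun t => twoHalf (v t) (θ t))) :
    Torus.IsGlobalLerayHopf ν (fun _ => g) (v 0) v ∧ meanPower g v ≤ meanDissipation ν v :=
  ⟨hu.planarSection_isGlobalLerayHopf hg, hu.planarSection_meanPower_le_meanDissipation hν hg hgz⟩

end Main

/-! ### Proof of the statement `PlanarDescentEnergyEqInitial` -/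

section Corrected

/-- **The descent for an `x₃`-invariant solution whose datum is its own slice `u 0`** (unbundled form of
`PlanarDescentEnergyEqInitial_holds`, with `g ∈ L²` in place of smoothness): write `u = (v, θ) ∘ π` with
`v t = πE ∘ u t ∘ σ`, `θ t = (u t ∘ σ)₂` (`Torus.eq_twoHalf_of_forall_add_single'`) and apply
`Torus.IsGlobalLerayHopf.planarSection_descent`. [cite: FoiasManleyRosaTemam2001, Ch. II Thm. 7.3] -/
theorem planarDescentEnergyEq_of_initial {ν : ℝ} {g : UnitAddTorus (Fin 2) → EuclideanSpace ℝ (Fin 2)}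
    {h : UnitAddTorus (Fin 2) → ℝ} {u : ℝ → UnitAddTorus (Fin 3) → EuclideanSpace ℝ (Fin 3)}
    (hν : 0 < ν) (hg : MemLp g 2 volume) (hgz : HasZeroMean g)
    (hu : Torus.IsGlobalLerayHopf ν (fun _ => twoHalf g h) (u 0) u)
    (hinv : ∀ (t : ℝ) (s : UnitAddCircle) (x : UnitAddTorus (Fin 3)), u t (x + Pi.single (2 : Fin 3) s) = u t x) :
    Torus.IsGlobalLerayHopf ν (fun _ => g) (fun y => planarProjE (u 0 (planarSect y)))
        (fun t y => planarProjE (u t (planarSect y))) ∧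
      meanPower g (fun t y => planarProjE (u t (planarSect y))) ≤
        meanDissipation ν (fun t y => planarProjE (u t (planarSect y))) := by
  have hfun : u = fun t => twoHalf (fun y => planarProjE (u t (planarSect y))) (fun y => u t (planarSect y) 2) :=
    funext fun t => eq_twoHalf_of_forall_add_single' (hinv t)
  rw [hfun] at hu
  exact Torus.IsGlobalLerayHopf.planarSection_descent (v := fun t y => planarProjE (u t (planarSect y)))
    (θ := fun t y => u t (planarSect y) 2) hν hg hgz hu

/-- **Proof of the corrected descent statement** (FMRT 2001, Ch. II Thm. 7.3 applied to the planar section; see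
the docstring of `PlanarDescentEnergyEqInitial` and the module note above): with `u 0 = u₀` this is
`planarDescentEnergyEq_of_initial` (only `ν > 0`, `g ∈ L²`, the zero mean of `g` and the `x₃`-invariance of the
slices `u t` are used). [cite: FoiasManleyRosaTemam2001, Ch. II Thm. 7.3] -/
theorem PlanarDescentEnergyEqInitial_holds : PlanarDescentEnergyEqInitial := by
  intro ν g h u₀ u hν hgs _hgd hgz _hhs hu h0 _hinv₀ hinv
  subst h0
  exact planarDescentEnergyEq_of_initial hν (hgs.memLp 2) hgz hu hinv

end Corrected

/-! ### Long-time averages do not see the slice `t = 0`; the update form of the descent -/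

section Update

variable {d : Type*} [Fintype d]

/-- The mean injected power does not see the slices `u t`, `t ≤ 0` (companion of the tree's
`meanDissipation_congr_of_eqOn_Ioi` / `meanEnergy_congr_of_eqOn_Ioi`, `LerayHopfGalileanTorusMeans`). [folklore] -/
theorem meanPower_congr_of_eqOn_Ioi (f : UnitAddTorus d → EuclideanSpace ℝ d)
    {u w : ℝ → UnitAddTorus d → EuclideanSpace ℝ d} (huw : ∀ t, 0 < t → u t = w t) :
    meanPower f u = meanPower f w :=
  longTimeAvgSup_congr_of_eqOn_Ioi fun t ht => by simp only [huw t ht]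

/-- **Update form of the descent, for an arbitrary `x₃`-invariant global Leray–Hopf solution with `L²` datum.**
Let `u` be a global Leray–Hopf solution on `T³` of NS_ν, `ν > 0`, driven by the steady `x₃`-invariant force
`(g, h) ∘ π` (`g ∈ L²(T²)` with zero mean), with `x₃`-invariant datum `u₀ ∈ L²` and `x₃`-invariant slices.  Then
the planar section `v t = πE ∘ u t ∘ σ` RE-DEFINED AT `t = 0` by the planar section `v₀ = πE ∘ u₀ ∘ σ` of the datum
is a global Leray–Hopf solution on `T²` driven by `g` with datum `v₀`, and the raw planar section obeys the
long-time budget `⟨g, v⟩ ≤ ⟨ν‖∇v‖²⟩` (apply `planarDescentEnergyEq_of_initial` to `Function.update u 0 u₀`, a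
global Leray–Hopf solution with the same datum by `Torus.IsGlobalLerayHopf.update_zero`; the long-time averages
do not see the slice `t = 0`).  This is the honest content of `PlanarDescentEnergyEq` for the accepted
`Torus.IsLerayHopfOn`. [cite: FoiasManleyRosaTemam2001, Ch. II Thm. 7.3] -/
theorem planarDescentEnergyEq_update {ν : ℝ} {g : UnitAddTorus (Fin 2) → EuclideanSpace ℝ (Fin 2)}
    {h : UnitAddTorus (Fin 2) → ℝ} {u₀ : UnitAddTorus (Fin 3) → EuclideanSpace ℝ (Fin 3)}
    {u : ℝ → UnitAddTorus (Fin 3) → EuclideanSpace ℝ (Fin 3)}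
    (hν : 0 < ν) (hg : MemLp g 2 volume) (hgz : HasZeroMean g)
    (hu : Torus.IsGlobalLerayHopf ν (fun _ => twoHalf g h) u₀ u) (hu₀ : MemLp u₀ 2 volume)
    (hinv₀ : ∀ (s : UnitAddCircle) (x : UnitAddTorus (Fin 3)), u₀ (x + Pi.single (2 : Fin 3) s) = u₀ x)
    (hinv : ∀ (t : ℝ) (s : UnitAddCircle) (x : UnitAddTorus (Fin 3)), u t (x + Pi.single (2 : Fin 3) s) = u t x) :
    Torus.IsGlobalLerayHopf ν (fun _ => g) (fun y => planarProjE (u₀ (planarSect y)))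
        (Function.update (fun t y => planarProjE (u t (planarSect y))) 0
          (fun y => planarProjE (u₀ (planarSect y)))) ∧
      meanPower g (fun t y => planarProjE (u t (planarSect y))) ≤
        meanDissipation ν (fun t y => planarProjE (u t (planarSect y))) := by
  -- re-define the free slice `t = 0` by the datum
  set w : ℝ → UnitAddTorus (Fin 3) → EuclideanSpace ℝ (Fin 3) := Function.update u 0 u₀ with hw_def
  have hw0 : w 0 = u₀ := Function.update_self 0 u₀ u
  have hwt : ∀ t : ℝ, t ≠ 0 → w t = u t := fun t ht => Function.update_of_ne ht u₀ u
  have hw : Torus.IsGlobalLerayHopf ν (fun _ => twoHalf g h) (w 0) w := by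
    rw [hw0]
    exact hu.update_zero hu₀
  have hwinv : ∀ (t : ℝ) (s : UnitAddCircle) (x : UnitAddTorus (Fin 3)), w t (x + Pi.single (2 : Fin 3) s) = w t x := by
    intro t s x
    rcases eq_or_ne t 0 with rfl | ht
    · rw [hw0]; exact hinv₀ s x
    · rw [hwt t ht]; exact hinv t s x
  obtain ⟨H1, H2⟩ := planarDescentEnergyEq_of_initial hν hg hgz hw hwinv
  have hsec : ∀ t, 0 < t →
      (fun y => planarProjE (u t (planarSect y))) = fun y => planarProjE (w t (planarSect y)) := fun t ht => by
    rw [hwt t ht.ne']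
  refine ⟨?_, ?_⟩
  · have hupd : Function.update (fun t y => planarProjE (u t (planarSect y))) 0
          (fun y => planarProjE (u₀ (planarSect y))) =
        fun t y => planarProjE (w t (planarSect y)) := by
      funext t
      rcases eq_or_ne t 0 with rfl | ht
      · rw [Function.update_self, hw0]
      · rw [Function.update_of_ne ht, hwt t ht]
    rw [hupd, ← hw0]
    exact H1
  · calc meanPower g (fun t y => planarProjE (u t (planarSect y)))
        = meanPower g (fun t y => planarProjE (w t (planarSect y))) := meanPower_congr_of_eqOn_Ioi g hsec
      _ ≤ meanDissipation ν (fun t y => planarProjE (w t (planarSect y))) := H2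
      _ = meanDissipation ν (fun t y => planarProjE (u t (planarSect y))) :=
        meanDissipation_congr_of_eqOn_Ioi fun t ht => (hsec t ht).symm

end Update

end Literature.Analysis.FluidPDE
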